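import Mathlib
import Literature.MathematicalPhysics.QuantumFieldTheory.Balaban1983to89.B8Eq194CriterionCarriersWitness
import Literature.MathematicalPhysics.QuantumFieldTheory.Balaban1983to89.B9Eq331LatticeCov

/-!
# [B8] (1.91) vs [4] (3.163): the criterion Q′ΔN(Q′) = 0 for a GENERAL FIBRE 𝔤 and at PURE-GAUGE backgrounds
# (cell GAPS G-B8-19 (c), part 7: reduction of the flat 𝔤-valued carriers to the scalar model; with part 6 and
# `B9Eq331LatticeCov`: the classification at every pure-gauge background, every 𝔤 ≠ 0, every dimension)

statement-level skeleton of published theorems with citation tags; proofs where landed; nothing here is a claim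
about the Yang–Mills mass gap

Seat p40 gen 9, Phase 2, B8 lane; seventh file of G-B8-19 (c) (parts 1–6: `B8Eq194Criterion`, `…Torus`, `…Dirichlet`,
`…Lattice`, `…Free`, `…Carriers`(+`Witness`); gauge covariance on the carriers: `B9Eq331LatticeCov`).  Kind: located
reading note, constants only — NOT an error of either paper.
WHY.  Parts 1–6 work in the SCALAR MODEL (fibre 𝔤 = ℝ, flat background U = 1); their HONEST SCOPE lists «non-abelian
𝔤 / U ≠ 1» as not covered.  On the carriers `B9Thm311Lattice` the fibre is any finite-dimensional real inner-product
space V (print: 𝔤 ⊂ u(N) with tr X*Y) and the background enters through the transports R(U(b)).  This file removes the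
first restriction and, for PURE-GAUGE backgrounds, the second: (i) with flat transports the 𝔤-valued Q′ of (3.19) and
Δ of (3.23) act «componentwise» — they commute with λ ↦ λ·v and with λ ↦ ⟨v, λ(·)⟩ — so «Δ maps N(Q′) into N(Q′)»
holds for the 𝔤-valued carriers iff it holds for the scalar ones (`criterion_fibre_iff`); (ii) a pure gauge
U(⟨x,x′⟩) = u(x)u(x′)⁻¹ is the gauge transform of U = 1, and the criterion is gauge invariant
(`B9Eq331LatticeCov.criterion_pureGauge_iff`, from [4] (3.31)–(3.32)).  Hence the classifications of part 6 hold at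
every pure-gauge background with every fibre 𝔤 ≠ 0.  Genuinely curved backgrounds (U(∂p) ≠ 1) remain outside: there
Q′ and Δ_U do not decouple and no classification is claimed.
CONTENT.
§1 `flatTV V X` (flat transports on the fibre V), `pathTr_flatTV`, `qL_flatTV_apply`; the componentwise maps
   `smulV v` (λ ↦ λ·v) and `innerV v` (λ ↦ ⟨v, λ(·)⟩) on PiLp 2 (ι → ·), adjoint to each other (`inner_smulV_left`,
   `inner_innerV_left`), `smulV_eq_zero_iff`, `eq_zero_of_forall_innerV`.
§2 Q′, D, Δ COMMUTE with them in the flat case: `qL_smulV`, `qL_innerV`, `DL_smulV`, `DL_innerV`, **`lapL_smulV`**,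
   **`lapL_innerV`**; hence **`criterion_fibre_iff`** (V ≠ 0): criterion for PiLp 2 (X → V) ⟺ for PiLp 2 (X → ℝ).
§3 CAPSTONES (every finite-dimensional fibre V ≠ 0, every pure gauge u : X → O(V), uniform block weights κ ≠ 0 on the
   blocks of a block map, contours ending at their sites, ANY (3.25)-data with a onto):
   **`criterion_pureGauge_iff_crit`** (⟺ `Crit (wOf bonds cb) 0 blk` of part 1); **`H4_eq_Hp_iff_crit_pureGauge`**
   ([4]'s H′ = (1.91)'s H′ ⟺ the scalar-model criterion); on the d-dimensional carriers of part 6: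
   **`H4_eq_Hp_iff_pureGauge_box`** (⟺ L = 1 ∨ K = 1) and **`H4_eq_Hp_iff_pureGauge_torus`**
   (⟺ L = 1 ∨ K = 1 ∨ (L, K) = (2, 2)).
§4 NON-VACUITY: `exists_data_pureGauge_box` (the (3.25)-data exist at every pure-gauge background for part 6b's
   printed cube geometry, `obvious_311_lattice`) and the hypothesis-free **`exists_data_Hp_ne_H4_pureGauge_box`**.

HONEST SCOPE.  Flat / pure-gauge backgrounds only; block sums ≡ means (uniform κ); unit bond weights in §3's box/torus;
the contours must end at their sites (the `last` clause — automatic for an `IsBlockSystem`, e.g. part 6b's); no bound,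
no row head changes.
Sources: [Balaban1985RegularSpaces] (1.91) p. 91 [PDF 17]; [Balaban1985BackgroundPropagators] (3.19) p. 393,
(3.21)–(3.25) p. 394, (3.28)–(3.33) pp. 395–396, (3.162)–(3.165) p. 429 [PDF 5–8, 41].
-/

namespace Literature.MathematicalPhysics.QuantumFieldTheory.Balaban1983to89.B8Eq194CriterionFibre

open Finset Literature.MathematicalPhysics.QuantumFieldTheory.Balaban1983to89.B9Eq323Ker
  Literature.MathematicalPhysics.QuantumFieldTheory.Balaban1983to89.B9Eq319Onto
  Literature.MathematicalPhysics.QuantumFieldTheory.Balaban1983to89.B9Thm311Lattice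
  Literature.MathematicalPhysics.QuantumFieldTheory.Balaban1983to89.B9Eq325Proj
  Literature.MathematicalPhysics.QuantumFieldTheory.Balaban1983to89.B8Eq191Hprime
  Literature.MathematicalPhysics.QuantumFieldTheory.Balaban1983to89.B8Eq194FirstTerm
  Literature.MathematicalPhysics.QuantumFieldTheory.Balaban1983to89.B8Eq194Criterion
  Literature.MathematicalPhysics.QuantumFieldTheory.Balaban1983to89.B8Eq194CriterionLattice
  Literature.MathematicalPhysics.QuantumFieldTheory.Balaban1983to89.B8Eq194CriterionCarriers
  Literature.MathematicalPhysics.QuantumFieldTheory.Balaban1983to89.B8Eq194CriterionCarriersWitness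
  Literature.MathematicalPhysics.QuantumFieldTheory.Balaban1983to89.B9Eq331LatticeCov
open scoped InnerProductSpace

/-! ## §1  Flat transports on a general fibre; the componentwise maps -/

section Flat

variable {X : Type*} {Y : Type*} (V : Type*) [NormedAddCommGroup V] [InnerProductSpace ℝ V]

/-- Flat background U = 1 on the fibre V: every bond transport is the identity.
[cite: Balaban1985BackgroundPropagators, (3.19) p. 393, (3.23) p. 394] -/
abbrev flatTV (X : Type*) : X → X → V →ₗ[ℝ] V := fun _ _ => LinearMap.id

variable {V}

/-- Along any contour the flat transport is the identity. [cite: Balaban1985BackgroundPropagators, (3.19) p. 393] -/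
theorem pathTr_flatTV : ∀ p : List X, pathTr (flatTV V X) p = LinearMap.id
  | [] => rfl
  | [_] => rfl
  | x :: x' :: rest => by
    rw [pathTr_cons_cons, pathTr_flatTV (x' :: rest)]
    rfl

/-- (3.19) with flat transports on the fibre V: (Q′f)(c) = Σ_{x ∈ B(c)} w(c,x) f(x).
[cite: Balaban1985BackgroundPropagators, (3.19) p. 393] -/
theorem qL_flatTV_apply (w : Y → X → ℝ) (B : Y → Finset X) (Γ : Y → X → List X) (y : Y → X)
    (f : PiLp 2 (fun _ : X => V)) (c : Y) :
    qL (flatTV V X) w B Γ y f c = ∑ x ∈ B c, w c x • WithLp.ofLp f x := by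
  rw [qL_apply]
  unfold avgQ
  refine Finset.sum_congr rfl fun x _ => ?_
  rw [pathTr_flatTV]
  rfl

end Flat

section Componentwise

variable {ι : Type*} {V : Type*} [NormedAddCommGroup V] [InnerProductSpace ℝ V]

/-- λ ↦ λ·v : scalar functions into V-valued ones (one «component» of the fibre).
[cite: Balaban1985BackgroundPropagators, (3.19) p. 393] -/
noncomputable def smulV (v : V) : PiLp 2 (fun _ : ι => ℝ) →ₗ[ℝ] PiLp 2 (fun _ : ι => V) where
  toFun f := WithLp.toLp 2 fun i => WithLp.ofLp f i • v
  map_add' f g := by ext i; simp [add_smul]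
  map_smul' r f := by ext i; simp [smul_smul]

/-- λ ↦ ⟨v, λ(·)⟩ : the v-component of a V-valued function. [cite: Balaban1985BackgroundPropagators, (3.19) p. 393] -/
noncomputable def innerV (v : V) : PiLp 2 (fun _ : ι => V) →ₗ[ℝ] PiLp 2 (fun _ : ι => ℝ) where
  toFun g := WithLp.toLp 2 fun i => ⟪v, WithLp.ofLp g i⟫_ℝ
  map_add' f g := by ext i; simp [inner_add_right]
  map_smul' r f := by ext i; simp [real_inner_smul_right]

/-- Pointwise form. [cite: Balaban1985BackgroundPropagators, (3.19) p. 393] -/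
theorem smulV_apply (v : V) (f : PiLp 2 (fun _ : ι => ℝ)) (i : ι) : smulV v f i = WithLp.ofLp f i • v := rfl
/-- Pointwise form. [cite: Balaban1985BackgroundPropagators, (3.19) p. 393] -/
theorem innerV_apply (v : V) (g : PiLp 2 (fun _ : ι => V)) (i : ι) : innerV v g i = ⟪v, WithLp.ofLp g i⟫_ℝ := rfl

/-- λ·v = 0 ⟺ λ = 0 for v ≠ 0. [folklore] -/
private theorem smulV_eq_zero_iff {v : V} (hv : v ≠ 0) (f : PiLp 2 (fun _ : ι => ℝ)) : smulV v f = 0 ↔ f = 0 := by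
  constructor
  · intro h
    ext i
    have hi := congrArg (fun g : PiLp 2 (fun _ : ι => V) => g i) h
    simp only [smulV_apply] at hi
    exact (smul_eq_zero.1 hi).resolve_right hv
  · rintro rfl
    exact map_zero _

/-- A V-valued function all of whose components vanish is zero. [folklore] -/
private theorem eq_zero_of_forall_innerV (g : PiLp 2 (fun _ : ι => V)) (h : ∀ v : V, innerV v g = 0) : g = 0 := by
  ext i
  have hi := congrArg (fun f : PiLp 2 (fun _ : ι => ℝ) => f i) (h (WithLp.ofLp g i))
  simp only [innerV_apply] at hi
  exact inner_self_eq_zero.1 hi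

variable [Fintype ι]

/-- The two maps are adjoint: ⟨λ·v, g⟩ = ⟨λ, ⟨v, g(·)⟩⟩. [cite: Balaban1985BackgroundPropagators, (3.24) p. 394] -/
theorem inner_smulV_left (v : V) (f : PiLp 2 (fun _ : ι => ℝ)) (g : PiLp 2 (fun _ : ι => V)) :
    ⟪smulV v f, g⟫_ℝ = ⟪f, innerV v g⟫_ℝ := by
  rw [PiLp.inner_apply, PiLp.inner_apply]
  refine Finset.sum_congr rfl fun i _ => ?_
  rw [smulV_apply, innerV_apply, real_inner_smul_left, show ∀ a b : ℝ, ⟪a, b⟫_ℝ = b * a from fun a b => rfl,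
    mul_comm]

/-- … and ⟨⟨v, g(·)⟩, f⟩ = ⟨g, f·v⟩. [cite: Balaban1985BackgroundPropagators, (3.24) p. 394] -/
theorem inner_innerV_left (v : V) (g : PiLp 2 (fun _ : ι => V)) (f : PiLp 2 (fun _ : ι => ℝ)) :
    ⟪innerV v g, f⟫_ℝ = ⟪g, smulV v f⟫_ℝ := by
  rw [real_inner_comm, ← inner_smulV_left, real_inner_comm]

end Componentwise

/-! ## §2  Flat Q′, D, Δ act componentwise; the criterion does not see the fibre -/

section Reduction

variable {X : Type*} {Y : Type*} {V : Type*} [NormedAddCommGroup V] [InnerProductSpace ℝ V]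

/-- Q′·(λv) = (Q′λ)·v (flat transports). [cite: Balaban1985BackgroundPropagators, (3.19) p. 393] -/
theorem qL_smulV (w : Y → X → ℝ) (B : Y → Finset X) (Γ : Y → X → List X) (y : Y → X) (v : V)
    (f : PiLp 2 (fun _ : X => ℝ)) :
    qL (flatTV V X) w B Γ y (smulV v f) = smulV v (qL (flatT X) w B Γ y f) := by
  ext c
  rw [qL_flatTV_apply, smulV_apply, qL_flat_apply, Finset.sum_smul]
  refine Finset.sum_congr rfl fun x _ => ?_
  rw [← smul_smul]
  rfl

/-- ⟨v, Q′g⟩ = Q′⟨v, g⟩ (flat transports). [cite: Balaban1985BackgroundPropagators, (3.19) p. 393] -/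
theorem qL_innerV (w : Y → X → ℝ) (B : Y → Finset X) (Γ : Y → X → List X) (y : Y → X) (v : V)
    (g : PiLp 2 (fun _ : X => V)) :
    qL (flatT X) w B Γ y (innerV v g) = innerV v (qL (flatTV V X) w B Γ y g) := by
  ext c
  rw [qL_flat_apply, innerV_apply, qL_flatTV_apply, inner_sum]
  refine Finset.sum_congr rfl fun x _ => ?_
  rw [real_inner_smul_right]
  rfl

/-- D(λv) = (Dλ)·v (flat transports). [cite: Balaban1985BackgroundPropagators, (3.23) p. 394] -/
theorem DL_smulV (bonds : Finset (X × X)) (cb : X × X → ℝ) (v : V) (f : PiLp 2 (fun _ : X => ℝ)) :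
    DL (flatTV V X) bonds cb (smulV v f) = smulV v (DL (flatT X) bonds cb f) := by
  ext b
  rw [DL_apply, smulV_apply, DL_apply]
  simp only [covD, LinearMap.id_apply, smul_eq_mul]
  show Real.sqrt (cb b.1) • (WithLp.ofLp f b.1.2 • v - WithLp.ofLp f b.1.1 • v)
    = (Real.sqrt (cb b.1) * (WithLp.ofLp f b.1.2 - WithLp.ofLp f b.1.1)) • v
  rw [← sub_smul, smul_smul]

/-- ⟨v, Dg⟩ = D⟨v, g⟩ (flat transports). [cite: Balaban1985BackgroundPropagators, (3.23) p. 394] -/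
theorem DL_innerV (bonds : Finset (X × X)) (cb : X × X → ℝ) (v : V) (g : PiLp 2 (fun _ : X => V)) :
    DL (flatT X) bonds cb (innerV v g) = innerV v (DL (flatTV V X) bonds cb g) := by
  ext b
  rw [DL_apply, innerV_apply, DL_apply]
  simp only [covD, LinearMap.id_apply, smul_eq_mul]
  show Real.sqrt (cb b.1) * (⟪v, WithLp.ofLp g b.1.2⟫_ℝ - ⟪v, WithLp.ofLp g b.1.1⟫_ℝ)
    = ⟪v, Real.sqrt (cb b.1) • (WithLp.ofLp g b.1.2 - WithLp.ofLp g b.1.1)⟫_ℝ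
  rw [real_inner_smul_right, inner_sub_right]

variable [Fintype X] [FiniteDimensional ℝ V]

/-- **Δ(λv) = (Δλ)·v** — the flat Laplacian (3.23) = D†D acts componentwise.
[cite: Balaban1985BackgroundPropagators, (3.23) p. 394] -/
theorem lapL_smulV (bonds : Finset (X × X)) (cb : X × X → ℝ) (v : V) (f : PiLp 2 (fun _ : X => ℝ)) :
    lapL (flatTV V X) bonds cb (smulV v f) = smulV v (lapL (flatT X) bonds cb f) := by
  refine ext_inner_right ℝ fun g => ?_
  rw [inner_lapL_left, DL_smulV, inner_smulV_left, ← DL_innerV, ← inner_lapL_left, inner_smulV_left]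

/-- **⟨v, Δg⟩ = Δ⟨v, g⟩.** [cite: Balaban1985BackgroundPropagators, (3.23) p. 394] -/
theorem lapL_innerV (bonds : Finset (X × X)) (cb : X × X → ℝ) (v : V) (g : PiLp 2 (fun _ : X => V)) :
    lapL (flatT X) bonds cb (innerV v g) = innerV v (lapL (flatTV V X) bonds cb g) := by
  refine ext_inner_right ℝ fun f => ?_
  rw [inner_lapL_left, DL_innerV, inner_innerV_left, ← DL_smulV, ← inner_lapL_left, inner_innerV_left]

/-- **The criterion does not see the fibre**: with flat transports, «Δ maps N(Q′) into N(Q′)» for 𝔤-valued functions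
(𝔤 = V ≠ 0) ⟺ the same for scalar functions. [cite: Balaban1985BackgroundPropagators, (3.19) p. 393, (3.23) p. 394,
(3.163)–(3.165) p. 429] -/
theorem criterion_fibre_iff [Nontrivial V] (w : Y → X → ℝ) (B : Y → Finset X) (Γ : Y → X → List X) (y : Y → X)
    (bonds : Finset (X × X)) (cb : X × X → ℝ) :
    (∀ g : PiLp 2 (fun _ : X => V), qL (flatTV V X) w B Γ y g = 0 →
        qL (flatTV V X) w B Γ y (lapL (flatTV V X) bonds cb g) = 0)
      ↔ (∀ f : PiLp 2 (fun _ : X => ℝ), qL (flatT X) w B Γ y f = 0 →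
        qL (flatT X) w B Γ y (lapL (flatT X) bonds cb f) = 0) := by
  constructor
  · intro h f hf
    obtain ⟨v, hv⟩ := exists_ne (0 : V)
    have h1 : qL (flatTV V X) w B Γ y (smulV v f) = 0 := by rw [qL_smulV, hf, map_zero]
    have h2 := h _ h1
    rw [lapL_smulV, qL_smulV] at h2
    exact (smulV_eq_zero_iff hv _).1 h2
  · intro h g hg
    refine eq_zero_of_forall_innerV _ fun v => ?_
    have h1 : qL (flatT X) w B Γ y (innerV v g) = 0 := by rw [qL_innerV, hg, map_zero]
    have h2 := h _ h1
    rw [lapL_innerV, qL_innerV] at h2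
    exact h2

end Reduction

/-! ## §3  Capstones: pure-gauge backgrounds, every fibre, every dimension -/

section Capstones

variable {X : Type*} {Y : Type*} {V : Type*} [NormedAddCommGroup V] [InnerProductSpace ℝ V]
variable [Fintype X] [Fintype Y] [DecidableEq X] [DecidableEq Y] [FiniteDimensional ℝ V] [Nontrivial V]

/-- **At a pure-gauge background U(⟨x,x′⟩) = u(x)u(x′)⁻¹, any fibre 𝔤 ≠ 0**, uniform block weights κ ≠ 0 on the
blocks of blk, bond weights c ≥ 0, contours ending at their sites: «Δ_U maps N(Q′(U)) into N(Q′(U))» ⟺ the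
scalar-model criterion `Crit (wOf bonds cb) 0 blk` of part 1 (gauge invariance `B9Eq331LatticeCov` + §2 + part 4).
[cite: Balaban1985BackgroundPropagators, (3.28)–(3.32) pp. 395–396, (3.163)–(3.165) p. 429] -/
theorem criterion_pureGauge_iff_crit (u : X → V ≃ₗᵢ[ℝ] V) (blk : X → Y) {κ : ℝ} (hκ : κ ≠ 0)
    {Γ : Y → X → List X} {y : Y → X}
    (hlast : ∀ c, ∀ x ∈ blocksOf blk c, (y c :: Γ c x).getLast (List.cons_ne_nil _ _) = x)
    (bonds : Finset (X × X)) (cb : X × X → ℝ) (hcb : ∀ b ∈ bonds, 0 ≤ cb b) :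
    (∀ l, qL (conjT u (flatTV V X)) (fun _ _ => κ) (blocksOf blk) Γ y l = 0 →
        qL (conjT u (flatTV V X)) (fun _ _ => κ) (blocksOf blk) Γ y
          (lapL (conjT u (flatTV V X)) bonds cb l) = 0)
      ↔ Crit (wOf bonds cb) 0 blk := by
  rw [criterion_pureGauge_iff u bonds cb hlast, criterion_fibre_iff]
  exact criterion_flat_iff blk hκ Γ y bonds cb hcb

/-- **[4]'s H′ = (1.91)'s H′ at a pure-gauge background, any fibre** ⟺ the scalar-model criterion — for ANY
(3.25)-data over these carriers with a onto. [cite: Balaban1985RegularSpaces, (1.91) p. 91;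
Balaban1985BackgroundPropagators, (3.163)–(3.165) p. 429, (3.33) p. 396] -/
theorem H4_eq_Hp_iff_crit_pureGauge (u : X → V ≃ₗᵢ[ℝ] V) (blk : X → Y) {κ : ℝ} (hκ : κ ≠ 0)
    {Γ : Y → X → List X} {y : Y → X}
    (hlast : ∀ c, ∀ x ∈ blocksOf blk c, (y c :: Γ c x).getLast (List.cons_ne_nil _ _) = x)
    (bonds : Finset (X × X)) (cb : X × X → ℝ) (hcb : ∀ b ∈ bonds, 0 ≤ cb b)
    {A : PiLp 2 (fun _ : Y => V) →ₗ[ℝ] PiLp 2 (fun _ : Y => V)}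
    {g : PiLp 2 (fun _ : X => V) →ₗ[ℝ] PiLp 2 (fun _ : X => V)}
    {c : PiLp 2 (fun _ : Y => V) →ₗ[ℝ] PiLp 2 (fun _ : Y => V)}
    (hdata : Data (lapL (conjT u (flatTV V X)) bonds cb) (qL (conjT u (flatTV V X)) (fun _ _ => κ) (blocksOf blk) Γ y)
      (LinearMap.adjoint (qL (conjT u (flatTV V X)) (fun _ _ => κ) (blocksOf blk) Γ y)) A g c)
    (hA : Function.Surjective A) :
    (∀ μ, H4 (qL (conjT u (flatTV V X)) (fun _ _ => κ) (blocksOf blk) Γ y)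
        (LinearMap.adjoint (qL (conjT u (flatTV V X)) (fun _ _ => κ) (blocksOf blk) Γ y)) A g c μ
        = Hp (LinearMap.adjoint (qL (conjT u (flatTV V X)) (fun _ _ => κ) (blocksOf blk) Γ y)) g c μ)
      ↔ Crit (wOf bonds cb) 0 blk :=
  ⟨fun hH => (criterion_pureGauge_iff_crit u blk hκ hlast bonds cb hcb).1 (criterion_of_H4_eq_Hp hdata hA hH),
    fun hc μ => H4_eq_Hp_of_criterion hdata ((criterion_pureGauge_iff_crit u blk hκ hlast bonds cb hcb).2 hc) μ⟩

end Capstones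

section Carriers

variable {ι : Type*} [Fintype ι] [DecidableEq ι] [Nonempty ι] {N : ℕ}
variable {V : Type*} [NormedAddCommGroup V] [InnerProductSpace ℝ V] [FiniteDimensional ℝ V] [Nontrivial V]

/-- Q′ of (3.19) on the d-dimensional carriers for the cubic blocks of side L at the pure-gauge background u, fibre V.
[cite: Balaban1985BackgroundPropagators, (3.19) p. 393, (3.28) p. 395] -/
noncomputable abbrev qBoxV (u : (ι → Fin N) → V ≃ₗᵢ[ℝ] V) (L K : ℕ) (hN : N = L * K) (κ : ℝ)
    (Γ : (ι → Fin K) → (ι → Fin N) → List (ι → Fin N)) (y : (ι → Fin K) → ι → Fin N) :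
    PiLp 2 (fun _ : ι → Fin N => V) →ₗ[ℝ] PiLp 2 (fun _ : ι → Fin K => V) :=
  qL (conjT u (flatTV V (ι → Fin N))) (fun _ _ => κ) (blocksOf (boxBlk L K hN)) Γ y

/-- **Free box, every dimension, every fibre 𝔤 ≠ 0, every pure-gauge background**: for uniform block weights κ ≠ 0,
contours ending at their sites, ANY (3.25)-data with a onto — [4]'s H′ ((3.163)) = (1.91)'s H′ ⟺ L = 1 ∨ K = 1.
[cite: Balaban1985RegularSpaces, (1.91) p. 91; Balaban1985BackgroundPropagators, (3.19) p. 393, (3.23)–(3.25)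
p. 394, (3.28)–(3.33) pp. 395–396, (3.163)–(3.165) p. 429] -/
theorem H4_eq_Hp_iff_pureGauge_box (u : (ι → Fin N) → V ≃ₗᵢ[ℝ] V) {L K : ℕ} (hN : N = L * K) (hL : 1 ≤ L)
    (hK : 1 ≤ K) {κ : ℝ} (hκ : κ ≠ 0) {Γ : (ι → Fin K) → (ι → Fin N) → List (ι → Fin N)}
    {y : (ι → Fin K) → ι → Fin N}
    (hlast : ∀ c, ∀ x ∈ blocksOf (boxBlk L K hN) c, (y c :: Γ c x).getLast (List.cons_ne_nil _ _) = x)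
    {A : PiLp 2 (fun _ : ι → Fin K => V) →ₗ[ℝ] PiLp 2 (fun _ : ι → Fin K => V)}
    {g : PiLp 2 (fun _ : ι → Fin N => V) →ₗ[ℝ] PiLp 2 (fun _ : ι → Fin N => V)}
    {c : PiLp 2 (fun _ : ι → Fin K => V) →ₗ[ℝ] PiLp 2 (fun _ : ι → Fin K => V)}
    (hdata : Data (lapL (conjT u (flatTV V (ι → Fin N))) (boxBonds ι N) (fun _ => 1)) (qBoxV u L K hN κ Γ y)
      (LinearMap.adjoint (qBoxV u L K hN κ Γ y)) A g c)
    (hA : Function.Surjective A) :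
    (∀ μ, H4 (qBoxV u L K hN κ Γ y) (LinearMap.adjoint (qBoxV u L K hN κ Γ y)) A g c μ
        = Hp (LinearMap.adjoint (qBoxV u L K hN κ Γ y)) g c μ)
      ↔ (L = 1 ∨ K = 1) := by
  rw [H4_eq_Hp_iff_crit_pureGauge u (boxBlk L K hN) hκ hlast (boxBonds ι N) (fun _ => 1) (fun _ _ => zero_le_one)
    hdata hA]
  exact crit_box_carriers_iff hN hL hK

/-- **Torus, every dimension, every fibre 𝔤 ≠ 0, every pure-gauge background**:
[4]'s H′ ((3.163)) = (1.91)'s H′ ⟺ L = 1 ∨ K = 1 ∨ (L, K) = (2, 2).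
[cite: Balaban1985RegularSpaces, (1.91) p. 91, p. 77 (T_η); Balaban1985BackgroundPropagators, (3.19) p. 393,
(3.23)–(3.25) p. 394, (3.28)–(3.33) pp. 395–396, (3.163)–(3.165) p. 429] -/
theorem H4_eq_Hp_iff_pureGauge_torus (u : (ι → Fin N) → V ≃ₗᵢ[ℝ] V) {L K : ℕ} (hN : N = L * K) (hL : 1 ≤ L)
    (hK : 1 ≤ K) {κ : ℝ} (hκ : κ ≠ 0) {Γ : (ι → Fin K) → (ι → Fin N) → List (ι → Fin N)}
    {y : (ι → Fin K) → ι → Fin N}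
    (hlast : ∀ c, ∀ x ∈ blocksOf (boxBlk L K hN) c, (y c :: Γ c x).getLast (List.cons_ne_nil _ _) = x)
    {A : PiLp 2 (fun _ : ι → Fin K => V) →ₗ[ℝ] PiLp 2 (fun _ : ι → Fin K => V)}
    {g : PiLp 2 (fun _ : ι → Fin N => V) →ₗ[ℝ] PiLp 2 (fun _ : ι → Fin N => V)}
    {c : PiLp 2 (fun _ : ι → Fin K => V) →ₗ[ℝ] PiLp 2 (fun _ : ι → Fin K => V)}
    (hdata : Data (lapL (conjT u (flatTV V (ι → Fin N))) (torusBonds ι N) (fun _ => 1)) (qBoxV u L K hN κ Γ y)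
      (LinearMap.adjoint (qBoxV u L K hN κ Γ y)) A g c)
    (hA : Function.Surjective A) :
    (∀ μ, H4 (qBoxV u L K hN κ Γ y) (LinearMap.adjoint (qBoxV u L K hN κ Γ y)) A g c μ
        = Hp (LinearMap.adjoint (qBoxV u L K hN κ Γ y)) g c μ)
      ↔ (L = 1 ∨ K = 1 ∨ (L = 2 ∧ K = 2)) := by
  rw [H4_eq_Hp_iff_crit_pureGauge u (boxBlk L K hN) hκ hlast (torusBonds ι N) (fun _ => 1) (fun _ _ => zero_le_one)
    hdata hA]
  exact crit_torus_carriers_iff hN hL hK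

end Carriers

/-! ## §4  Non-vacuity at pure-gauge backgrounds (the printed cube geometry of part 6b) -/

section Witness

variable {V : Type*} [NormedAddCommGroup V] [InnerProductSpace ℝ V] [FiniteDimensional ℝ V]

open B8Eq194CriterionCarriersWitness

omit [FiniteDimensional ℝ V] in
/-- The weight operator a = diag(a_c) of (3.24) is onto on the 𝔤-valued carriers when every a_c ≠ 0 (part 4's
`AL_surjective` is the scalar case). [cite: Balaban1985BackgroundPropagators, (3.24) p. 394] -/
theorem AL_surjectiveV {Y : Type*} (a : Y → ℝ) (ha : ∀ c, a c ≠ 0) : Function.Surjective (AL (V := V) a) := by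
  intro φ
  refine ⟨WithLp.toLp 2 (fun c => (a c)⁻¹ • WithLp.ofLp φ c), ?_⟩
  ext c
  rw [AL_apply]
  show a c • ((a c)⁻¹ • WithLp.ofLp φ c) = WithLp.ofLp φ c
  rw [smul_smul, mul_inv_cancel₀ (ha c), one_smul]

/-- **The (3.25)-data EXIST at every pure-gauge background** on the d-dimensional box carriers with the printed cubes
(corner centres, axis-by-axis contours), any fibre, uniform κ ≠ 0, a = diag(a_c) > 0 — [4] Thm 3.11 «obvious» on the
lattice (`B9Thm311Lattice.obvious_311_lattice`) at the transports u(x)u(x′)⁻¹.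
[cite: Balaban1985BackgroundPropagators, (3.24)–(3.25) p. 394, (3.28) p. 395, Thm 3.11 p. 416] -/
theorem exists_data_pureGauge_box (d K l : ℕ) (u : (Fin d → Fin (nSide K l)) → V ≃ₗᵢ[ℝ] V) {κ : ℝ} (hκ : κ ≠ 0)
    (a : (Fin d → Fin K) → ℝ) (ha : ∀ c, 0 < a c) :
    ∃ (g : PiLp 2 (fun _ : Fin d → Fin (nSide K l) => V) →ₗ[ℝ] PiLp 2 (fun _ : Fin d → Fin (nSide K l) => V))
      (c : PiLp 2 (fun _ : Fin d → Fin K => V) →ₗ[ℝ] PiLp 2 (fun _ : Fin d → Fin K => V)),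
      Data (lapL (conjT u (flatTV V (Fin d → Fin (nSide K l)))) (boxBonds (Fin d) (nSide K l)) (fun _ => 1))
        (qBoxV u (l + 1) K rfl κ (ΓBox d K l) (yBox d K l))
        (LinearMap.adjoint (qBoxV u (l + 1) K rfl κ (ΓBox d K l) (yBox d K l))) (AL a) g c := by
  obtain ⟨g, c, h, -⟩ := obvious_311_lattice (conjT u (flatTV V (Fin d → Fin (nSide K l))))
    (conjT_injective u fun _ _ => fun _ _ h => h) (fun _ => (1 : ℝ)) (fun _ _ => zero_lt_one)
    (isBlockSystem_box d K l hκ) a ha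
  exact ⟨g, c, h⟩

/-- **Hypothesis-free, every fibre 𝔤 ≠ 0, every pure gauge, every d ≥ 1: on the free box with the printed cubes,
L ≥ 2 and K ≥ 2, the (3.25)-data exist and (1.91)'s H′ ≠ [4]'s (3.163) on them.**
[cite: Balaban1985RegularSpaces, (1.91) p. 91; Balaban1985BackgroundPropagators, (3.18)–(3.19) p. 393, (3.24)–(3.25)
p. 394, (3.28)–(3.33) pp. 395–396, (3.163)–(3.165) p. 429] -/
theorem exists_data_Hp_ne_H4_pureGauge_box [Nontrivial V] {d K l : ℕ} (hd : 0 < d) (hl : 1 ≤ l) (hK : 2 ≤ K)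
    (u : (Fin d → Fin (nSide K l)) → V ≃ₗᵢ[ℝ] V) {κ : ℝ} (hκ : κ ≠ 0) (a : (Fin d → Fin K) → ℝ)
    (ha : ∀ c, 0 < a c) :
    ∃ (g : PiLp 2 (fun _ : Fin d → Fin (nSide K l) => V) →ₗ[ℝ] PiLp 2 (fun _ : Fin d → Fin (nSide K l) => V))
      (c : PiLp 2 (fun _ : Fin d → Fin K => V) →ₗ[ℝ] PiLp 2 (fun _ : Fin d → Fin K => V)),
      Data (lapL (conjT u (flatTV V (Fin d → Fin (nSide K l)))) (boxBonds (Fin d) (nSide K l)) (fun _ => 1))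
          (qBoxV u (l + 1) K rfl κ (ΓBox d K l) (yBox d K l))
          (LinearMap.adjoint (qBoxV u (l + 1) K rfl κ (ΓBox d K l) (yBox d K l))) (AL a) g c ∧
        ∃ μ, H4 (qBoxV u (l + 1) K rfl κ (ΓBox d K l) (yBox d K l))
            (LinearMap.adjoint (qBoxV u (l + 1) K rfl κ (ΓBox d K l) (yBox d K l))) (AL a) g c μ
          ≠ Hp (LinearMap.adjoint (qBoxV u (l + 1) K rfl κ (ΓBox d K l) (yBox d K l))) g c μ := by
  haveI : Nonempty (Fin d) := ⟨⟨0, hd⟩⟩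
  obtain ⟨g, c, hdata⟩ := exists_data_pureGauge_box d K l u hκ a ha
  refine ⟨g, c, hdata, ?_⟩
  by_contra hall
  push Not at hall
  have h := (H4_eq_Hp_iff_pureGauge_box u (L := l + 1) (K := K) rfl (by omega) (by omega) hκ
    (isBlockSystem_box d K l hκ).last hdata (AL_surjectiveV a fun c => (ha c).ne')).1 hall
  rcases h with h1 | h1 <;> omega

end Witness

end Literature.MathematicalPhysics.QuantumFieldTheory.Balaban1983to89.B8Eq194CriterionFibre
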